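import Mathlib
import Literature.RingTheory.MvPolynomial.LinearFormsCoeff
import Summits.ValiantsHypothesis.ValiantsHypothesis.Theorems.RigidityForcesSymmetryRankRigidMinimalReprLaplaceFiveStarLemmaKDirectional
import Summits.ValiantsHypothesis.ValiantsHypothesis.Theorems.RigidityForcesSymmetryRankRigidMinimalReprLaplaceFiveStarLemmaKBinaryCubic

/-!
# ValiantsHypothesis / RigidityForcesSymmetry — crux `LaplaceOptimalFive` (stmt-ValiantsHypothesis-24813), crux idea
`young-shadow` (K1) on the star: **LEMMA K, CASE (c1) — A COMMON LINEAR FACTOR: `K = 0`, OR A SQUARE MEMBER**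
(referee note `NOTE-crit3g5-24813-Lemma2prime-elementary.md` §B (c1); memo `NOTE-p4g15-24813-K1-star.md` §14 (c1))

Pencil `L·⟨M₁, M₂⟩` (`U_i = l m_iᵀ + m_i lᵀ`), cubic form `K` with all `3 × 3` minors of `[∂K | ∂Q₁ | ∂Q₂]` zero.  If `l, m₁, m₂` are
linearly DEPENDENT the pencil contains a square (or degenerates, excluded by independence of `U₁, U₂`); if they are INDEPENDENT (a
non-zero `3 × 3` minor), explicit DUAL VECTORS `v₀, v₁, v₂` (Cramer) replace the paper's coordinates `(y₀, y₁, y₂) = (ℓ, m₁, m₂)`: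
`D_{v₀}Q₁ = 2M₁`, `D_{v₁}Q₁ = 2L`, `D_{v₂}Q₁ = 0`, …; the contracted minor gives `L·D_{v₀}K = M₁·D_{v₁}K + M₂·D_{v₂}K` and `D_vK = 0` on
the common kernel, so Euler reads `3K = 2L·D_{v₀}K`; the DESCENT `C(γ)F = 2L·D_{v₀}F ⟹ F = L·G, C(γ−2)G = 2L·D_{v₀}G`
(`γ = 3, 1, −1, −3 ≠ 0`) ends with `K = 0` — the paper's «every monomial `y₀^a y₁^b y₂^c` has `a = b + c`».

★ `cubic_of_commonFactor`: `K = 0 ∨ (square member)`.  Also `det3_sum_first`, `dirDeriv_quadric_commonFactor`, `descent_step`,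
`descent_base`.  Pure algebra; no star hypotheses, no definitions, no `sorry`.  Honest framing: helper toward the Lean price (L2) of the
K1-on-the-star theorem (PAPER, referee PASS; not kernel); `LaplaceOptimalFive` OPEN · CONTESTED 72/120; `VP ≠ VNP` NOT proved.
-/

set_option linter.dupNamespace false

namespace Summit.ValiantsHypothesis.ValiantsHypothesis.Theorems.RigidityForcesSymmetryRankRigidMinimalRepr

namespace LaplaceFiveStar

open Finset MvPolynomial

/-- Multilinearity in the FIRST row: if `det[(k_a,p_a,q_a); (D,E,F); (G,H,I)] = 0` for every `a`, then the determinant with first row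
`(Σ v_a k_a, Σ v_a p_a, Σ v_a q_a)` vanishes too (any commutative ring). [folklore] -/
theorem det3_sum_first {R : Type*} [CommRing R] {ι : Type*} [Fintype ι] (D E F G H I : R) (k p q v : ι → R)
    (h : ∀ a, k a * (E * I - H * F) - D * (p a * I - H * q a) + G * (p a * F - E * q a) = 0) :
    (∑ a, v a * k a) * (E * I - H * F) - D * ((∑ a, v a * p a) * I - H * (∑ a, v a * q a))
      + G * ((∑ a, v a * p a) * F - E * (∑ a, v a * q a)) = 0 := by
  have e : ∀ a, v a * (k a * (E * I - H * F) - D * (p a * I - H * q a) + G * (p a * F - E * q a))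
      = (E * I - H * F) * (v a * k a) + (G * F - D * I) * (v a * p a) + (D * H - G * E) * (v a * q a) := fun a => by
    ring
  have hs : ∑ a, v a * (k a * (E * I - H * F) - D * (p a * I - H * q a) + G * (p a * F - E * q a)) = 0 :=
    Finset.sum_eq_zero fun a _ => by rw [h a, mul_zero]
  rw [Finset.sum_congr rfl fun a _ => e a, Finset.sum_add_distrib, Finset.sum_add_distrib, ← Finset.mul_sum,
    ← Finset.mul_sum, ← Finset.mul_sum] at hs
  linear_combination hs

/-- **Triple contraction.**  If all `3 × 3` minors of `[k | p | q]` vanish then so does the determinant of the three contracted rows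
`(K_{v_r}, P_{v_r}, Q_{v_r})`, `r = 0,1,2` (any commutative ring). [folklore] -/
theorem det3_contract {R : Type*} [CommRing R] {ι : Type*} [Fintype ι] (k p q : ι → R)
    (hT : ∀ a b c, k a * (p b * q c - p c * q b) - k b * (p a * q c - p c * q a) + k c * (p a * q b - p b * q a) = 0)
    (v₀ v₁ v₂ : ι → R) :
    (∑ a, v₀ a * k a) * ((∑ b, v₁ b * p b) * (∑ c, v₂ c * q c) - (∑ c, v₂ c * p c) * (∑ b, v₁ b * q b))
      - (∑ b, v₁ b * k b) * ((∑ a, v₀ a * p a) * (∑ c, v₂ c * q c) - (∑ c, v₂ c * p c) * (∑ a, v₀ a * q a))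
      + (∑ c, v₂ c * k c) * ((∑ a, v₀ a * p a) * (∑ b, v₁ b * q b) - (∑ b, v₁ b * p b) * (∑ a, v₀ a * q a)) = 0 := by
  have h1 : ∀ a c, k a * ((∑ b, v₁ b * p b) * q c - p c * (∑ b, v₁ b * q b))
      - (∑ b, v₁ b * k b) * (p a * q c - p c * q a) + k c * (p a * (∑ b, v₁ b * q b) - (∑ b, v₁ b * p b) * q a) = 0 :=
    fun a c => det3_sum_mid (k a) (p a) (q a) (k c) (p c) (q c) k p q v₁ (fun b => hT a b c)
  have h2 : ∀ a, k a * ((∑ b, v₁ b * p b) * (∑ c, v₂ c * q c) - (∑ c, v₂ c * p c) * (∑ b, v₁ b * q b))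
      - (∑ b, v₁ b * k b) * (p a * (∑ c, v₂ c * q c) - (∑ c, v₂ c * p c) * q a)
      + (∑ c, v₂ c * k c) * (p a * (∑ b, v₁ b * q b) - (∑ b, v₁ b * p b) * q a) = 0 :=
    fun a => det3_sum_last (k a) (p a) (q a) (∑ b, v₁ b * k b) (∑ b, v₁ b * p b) (∑ b, v₁ b * q b) k p q v₂ (h1 a)
  exact det3_sum_first (∑ b, v₁ b * k b) (∑ b, v₁ b * p b) (∑ b, v₁ b * q b) (∑ c, v₂ c * k c) (∑ c, v₂ c * p c)
    (∑ c, v₂ c * q c) k p q v₀ h2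

/-- Directional derivative of a quadric with matrix `l mᵀ + m lᵀ`:  `D_v Q = 2 (C(v·l) · M + C(v·m) · L)`,
`L = Σ l_z X_z`, `M = Σ m_z X_z`. [folklore] -/
theorem dirDeriv_quadric_commonFactor (U : Fin 5 → Fin 5 → ℂ) (l m : Fin 5 → ℂ)
    (hU : ∀ x w : Fin 5, U x w = l x * m w + m x * l w) (Q : MvPolynomial (Fin 5) ℂ)
    (hQ : Q = ∑ a : Fin 5, ∑ b : Fin 5, C (U a b) * X a * X b) (v : Fin 5 → ℂ) :
    ∑ a : Fin 5, C (v a) * pderiv a Q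
      = 2 * (C (∑ a : Fin 5, v a * l a) * (∑ z : Fin 5, m z • (X z : MvPolynomial (Fin 5) ℂ))
        + C (∑ a : Fin 5, v a * m a) * (∑ z : Fin 5, l z • (X z : MvPolynomial (Fin 5) ℂ))) := by
  rw [hQ, dirDeriv_quadric, mul_add, Finset.mul_sum, Finset.mul_sum, Finset.mul_sum, Finset.mul_sum, ← Finset.sum_add_distrib]
  refine Finset.sum_congr rfl fun d _ => ?_
  have e : ∑ a : Fin 5, v a * (U a d + U d a) = 2 * ((∑ a : Fin 5, v a * l a) * m d + (∑ a : Fin 5, v a * m a) * l d) := by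
    rw [Finset.sum_mul, Finset.sum_mul, ← Finset.sum_add_distrib, Finset.mul_sum]
    exact Finset.sum_congr rfl fun a _ => by rw [hU a d, hU d a]; ring
  rw [e, smul_eq_C_mul, smul_eq_C_mul]
  simp only [map_add, map_mul, map_ofNat]
  ring

/-- **Descent step.**  `L = Σ l_z X_z`, `v₀·l = 1`, `D₀ = D_{v₀}`; if `F` is a form of degree `n+1` with `C γ · F = 2 L · D₀ F` and
`γ ≠ 0`, then `F = L · G` with `G` a form of degree `n` and `C(γ−2) · G = 2 L · D₀ G`. [folklore] -/
theorem descent_step (l v₀ : Fin 5 → ℂ) (hv₀ : ∑ a : Fin 5, v₀ a * l a = 1) (z₀ : Fin 5) (hl : l z₀ ≠ 0)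
    (γ : ℂ) (hγ : γ ≠ 0) (n : ℕ) (F : MvPolynomial (Fin 5) ℂ) (hF : F.IsHomogeneous (n + 1))
    (h : C γ * F = 2 * (∑ z : Fin 5, l z • (X z : MvPolynomial (Fin 5) ℂ)) * ∑ a : Fin 5, C (v₀ a) * pderiv a F) :
    ∃ G : MvPolynomial (Fin 5) ℂ, G.IsHomogeneous n ∧ F = (∑ z : Fin 5, l z • (X z : MvPolynomial (Fin 5) ℂ)) * G ∧
      C (γ - 2) * G = 2 * (∑ z : Fin 5, l z • (X z : MvPolynomial (Fin 5) ℂ)) * ∑ a : Fin 5, C (v₀ a) * pderiv a G := by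
  set L : MvPolynomial (Fin 5) ℂ := ∑ z : Fin 5, l z • (X z : MvPolynomial (Fin 5) ℂ) with hL
  have hL1 : L.IsHomogeneous 1 := Literature.RingTheory.MvPolynomial.isHomogeneous_one_sum_smul_X l
  have hL0 : L ≠ 0 := by
    intro h0
    have := (Literature.RingTheory.MvPolynomial.sum_smul_X_eq_zero_iff l).mp h0
    exact hl (by rw [this]; rfl)
  have hdvd : L ∣ C γ * F := ⟨2 * ∑ a : Fin 5, C (v₀ a) * pderiv a F, by rw [h]; ring⟩
  have hu : IsUnit (C γ : MvPolynomial (Fin 5) ℂ) := (isUnit_iff_ne_zero.mpr hγ).map C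
  obtain ⟨G, hG⟩ := (hu.dvd_mul_left).mp hdvd
  have hGh : G.IsHomogeneous n := isHomogeneous_of_mul_eq (d := n) (m := 1) (n := n + 1) hL1 hL0 hF
    (by rw [hG]; ring) rfl
  refine ⟨G, hGh, hG, ?_⟩
  have hD : ∑ a : Fin 5, C (v₀ a) * pderiv a F = G + L * ∑ a : Fin 5, C (v₀ a) * pderiv a G := by
    rw [hG, dirDeriv_mul, hL, dirDeriv_sum_smul_X, hv₀, C_1, one_mul]
  rw [hD, hG] at h
  apply mul_left_cancel₀ hL0
  rw [map_sub, map_ofNat]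
  linear_combination h

/-- **Descent base.**  A form of degree `0` with `C γ · F = 2 L · D₀ F`, `γ ≠ 0`, vanishes. [folklore] -/
theorem descent_base (l v₀ : Fin 5 → ℂ) (γ : ℂ) (hγ : γ ≠ 0) (F : MvPolynomial (Fin 5) ℂ) (hF : F.IsHomogeneous 0)
    (h : C γ * F = 2 * (∑ z : Fin 5, l z • (X z : MvPolynomial (Fin 5) ℂ)) * ∑ a : Fin 5, C (v₀ a) * pderiv a F) :
    F = 0 := by
  have hc := eq_C_of_isHomogeneous_zero hF
  rw [hc, dirDeriv_C, mul_zero, ← map_mul, C_eq_zero, mul_eq_zero] at h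
  rw [hc, h.resolve_left hγ, C_0]

/-- A sum against a three-point vector divided by `Δ`. [folklore] -/
theorem sum_three_point_div (i j z : Fin 5) (c₀ c₁ c₂ Δ : ℂ) (f : Fin 5 → ℂ) :
    ∑ a : Fin 5, ((if a = i then c₀ else 0) + (if a = j then c₁ else 0) + (if a = z then c₂ else 0)) / Δ * f a
      = (c₀ * f i + c₁ * f j + c₂ * f z) / Δ := by
  have e : ∀ a : Fin 5, ((if a = i then c₀ else 0) + (if a = j then c₁ else 0) + (if a = z then c₂ else 0)) / Δ * f a
      = ((if a = i then c₀ * f a else 0) + (if a = j then c₁ * f a else 0) + (if a = z then c₂ * f a else 0)) / Δ := by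
    intro a
    split_ifs <;> ring
  rw [Finset.sum_congr rfl fun a _ => e a, ← Finset.sum_div, Finset.sum_add_distrib, Finset.sum_add_distrib,
    Finset.sum_ite_eq', Finset.sum_ite_eq', Finset.sum_ite_eq']
  simp

/-- **LEMMA K, case (c1): common linear factor.**  Two independent symmetric quadrics of the shape `U_i = l m_iᵀ + m_i lᵀ` (`l ≠ 0`),
a cubic form `K` with all `3 × 3` minors of `[∂K | ∂Q₁ | ∂Q₂]` zero.  Then `K = 0`, or the pencil contains a SQUARE member
(`s U₁ + t U₂ = λλᵀ`, `(s,t) ≠ 0` — the degenerate case `l, m₁, m₂` dependent). [folklore] -/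
theorem cubic_of_commonFactor (U₁ U₂ : Fin 5 → Fin 5 → ℂ)
    (hind : ∀ s t : ℂ, (∀ x w : Fin 5, s * U₁ x w + t * U₂ x w = 0) → s = 0 ∧ t = 0)
    (Q₁ Q₂ K : MvPolynomial (Fin 5) ℂ)
    (hQ₁ : Q₁ = ∑ a : Fin 5, ∑ b : Fin 5, C (U₁ a b) * X a * X b)
    (hQ₂ : Q₂ = ∑ a : Fin 5, ∑ b : Fin 5, C (U₂ a b) * X a * X b)
    (hK3 : K.IsHomogeneous 3)
    (hT : ∀ a b c : Fin 5,
      pderiv a K * (pderiv b Q₁ * pderiv c Q₂ - pderiv c Q₁ * pderiv b Q₂)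
        - pderiv b K * (pderiv a Q₁ * pderiv c Q₂ - pderiv c Q₁ * pderiv a Q₂)
        + pderiv c K * (pderiv a Q₁ * pderiv b Q₂ - pderiv b Q₁ * pderiv a Q₂) = 0)
    (l m₁ m₂ : Fin 5 → ℂ) (z₀ : Fin 5) (hl : l z₀ ≠ 0)
    (hcf : ∀ x w : Fin 5, U₁ x w = l x * m₁ w + m₁ x * l w ∧ U₂ x w = l x * m₂ w + m₂ x * l w) :
    K = 0 ∨ (∃ lam : Fin 5 → ℂ, ∃ s t : ℂ, (s ≠ 0 ∨ t ≠ 0) ∧ ∀ x w : Fin 5, s * U₁ x w + t * U₂ x w = lam x * lam w) := by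
  classical
  by_cases hdep1 : ∀ i j : Fin 5, l i * m₁ j - l j * m₁ i = 0
  · -- `m₁ ∥ l`: `U₁ = 2c · l lᵀ`
    right
    have hm1 : ∀ z : Fin 5, m₁ z = m₁ z₀ / l z₀ * l z := fun z => by
      rw [div_mul_eq_mul_div, eq_div_iff hl]
      linear_combination hdep1 z₀ z
    by_cases hc : m₁ z₀ = 0
    · exfalso
      have h10 := hind 1 0 fun x w => by
        rw [(hcf x w).1, hm1 x, hm1 w, hc]; ring
      exact one_ne_zero h10.1
    · refine ⟨l, l z₀ / (2 * m₁ z₀), 0, Or.inl (div_ne_zero hl (mul_ne_zero two_ne_zero hc)), fun x w => ?_⟩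
      rw [(hcf x w).1, hm1 x, hm1 w]
      field_simp
      ring
  simp only [not_forall] at hdep1
  obtain ⟨i, j, hD⟩ := hdep1
  by_cases hdep2 : ∀ z : Fin 5, m₂ z * (l i * m₁ j - l j * m₁ i) - m₁ z * (l i * m₂ j - l j * m₂ i)
      + l z * (m₁ i * m₂ j - m₁ j * m₂ i) = 0
  · -- `m₂ ∈ span{l, m₁}`: `U₂ = β U₁ + 2α l lᵀ`
    right
    set β : ℂ := (l i * m₂ j - l j * m₂ i) / (l i * m₁ j - l j * m₁ i) with hβ
    set α : ℂ := -(m₁ i * m₂ j - m₁ j * m₂ i) / (l i * m₁ j - l j * m₁ i) with hα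
    have hm2 : ∀ z : Fin 5, m₂ z = β * m₁ z + α * l z := by
      intro z
      rw [hβ, hα, div_mul_eq_mul_div, div_mul_eq_mul_div, ← add_div, eq_div_iff hD]
      linear_combination hdep2 z
    by_cases hα0 : m₁ i * m₂ j - m₁ j * m₂ i = 0
    · exfalso
      have h01 := hind (-β) 1 fun x w => by
        rw [(hcf x w).1, (hcf x w).2, hm2 x, hm2 w, hα, hα0]; ring
      exact one_ne_zero h01.2
    · have hαne : α ≠ 0 := by
        rw [hα]; exact div_ne_zero (neg_ne_zero.mpr hα0) hD
      refine ⟨l, -β / (2 * α), 1 / (2 * α), Or.inr (div_ne_zero one_ne_zero (mul_ne_zero two_ne_zero hαne)),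
        fun x w => ?_⟩
      rw [(hcf x w).1, (hcf x w).2, hm2 x, hm2 w]
      field_simp
      ring
  · -- `l, m₁, m₂` independent: `K = 0`
    left
    simp only [not_forall] at hdep2
    obtain ⟨z, hΔ⟩ := hdep2
    set Δ : ℂ := m₂ z * (l i * m₁ j - l j * m₁ i) - m₁ z * (l i * m₂ j - l j * m₂ i) + l z * (m₁ i * m₂ j - m₁ j * m₂ i)
      with hΔdef
    -- dual vectors by Cramer
    set v₀ : Fin 5 → ℂ := fun a => ((if a = i then m₁ j * m₂ z - m₁ z * m₂ j else 0)
      + (if a = j then -(m₁ i * m₂ z - m₁ z * m₂ i) else 0) + (if a = z then m₁ i * m₂ j - m₁ j * m₂ i else 0)) / Δ with hv₀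
    set v₁ : Fin 5 → ℂ := fun a => ((if a = i then -(l j * m₂ z - l z * m₂ j) else 0)
      + (if a = j then l i * m₂ z - l z * m₂ i else 0) + (if a = z then -(l i * m₂ j - l j * m₂ i) else 0)) / Δ with hv₁
    set v₂ : Fin 5 → ℂ := fun a => ((if a = i then l j * m₁ z - l z * m₁ j else 0)
      + (if a = j then -(l i * m₁ z - l z * m₁ i) else 0) + (if a = z then l i * m₁ j - l j * m₁ i else 0)) / Δ with hv₂
    have d0l : ∑ a : Fin 5, v₀ a * l a = 1 := by
      simp only [hv₀]; rw [sum_three_point_div, div_eq_one_iff_eq hΔ, hΔdef]; ring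
    have d0m1 : ∑ a : Fin 5, v₀ a * m₁ a = 0 := by
      simp only [hv₀]; rw [sum_three_point_div, div_eq_zero_iff]; left; ring
    have d0m2 : ∑ a : Fin 5, v₀ a * m₂ a = 0 := by
      simp only [hv₀]; rw [sum_three_point_div, div_eq_zero_iff]; left; ring
    have d1l : ∑ a : Fin 5, v₁ a * l a = 0 := by
      simp only [hv₁]; rw [sum_three_point_div, div_eq_zero_iff]; left; ring
    have d1m1 : ∑ a : Fin 5, v₁ a * m₁ a = 1 := by
      simp only [hv₁]; rw [sum_three_point_div, div_eq_one_iff_eq hΔ, hΔdef]; ring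
    have d1m2 : ∑ a : Fin 5, v₁ a * m₂ a = 0 := by
      simp only [hv₁]; rw [sum_three_point_div, div_eq_zero_iff]; left; ring
    have d2l : ∑ a : Fin 5, v₂ a * l a = 0 := by
      simp only [hv₂]; rw [sum_three_point_div, div_eq_zero_iff]; left; ring
    have d2m1 : ∑ a : Fin 5, v₂ a * m₁ a = 0 := by
      simp only [hv₂]; rw [sum_three_point_div, div_eq_zero_iff]; left; ring
    have d2m2 : ∑ a : Fin 5, v₂ a * m₂ a = 1 := by
      simp only [hv₂]; rw [sum_three_point_div, div_eq_one_iff_eq hΔ, hΔdef]; ring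
    -- the polynomials
    set L : MvPolynomial (Fin 5) ℂ := ∑ t : Fin 5, l t • (X t : MvPolynomial (Fin 5) ℂ) with hL
    set M₁f : MvPolynomial (Fin 5) ℂ := ∑ t : Fin 5, m₁ t • (X t : MvPolynomial (Fin 5) ℂ) with hM₁
    set M₂f : MvPolynomial (Fin 5) ℂ := ∑ t : Fin 5, m₂ t • (X t : MvPolynomial (Fin 5) ℂ) with hM₂
    have hL0 : L ≠ 0 := by
      intro h0
      have := (Literature.RingTheory.MvPolynomial.sum_smul_X_eq_zero_iff l).mp h0
      exact hl (by rw [this]; rfl)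
    have hDQ1 : ∀ v : Fin 5 → ℂ, ∑ a : Fin 5, C (v a) * pderiv a Q₁
        = 2 * (C (∑ a : Fin 5, v a * l a) * M₁f + C (∑ a : Fin 5, v a * m₁ a) * L) :=
      fun v => dirDeriv_quadric_commonFactor U₁ l m₁ (fun x w => (hcf x w).1) Q₁ hQ₁ v
    have hDQ2 : ∀ v : Fin 5 → ℂ, ∑ a : Fin 5, C (v a) * pderiv a Q₂
        = 2 * (C (∑ a : Fin 5, v a * l a) * M₂f + C (∑ a : Fin 5, v a * m₂ a) * L) :=
      fun v => dirDeriv_quadric_commonFactor U₂ l m₂ (fun x w => (hcf x w).2) Q₂ hQ₂ v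
    -- contracted minors: Σ C(v a) * k a written as Σ (C∘v) a * k a
    have hcontr := fun (w₀ w₁ w₂ : Fin 5 → ℂ) =>
      det3_contract (fun a => pderiv a K) (fun a => pderiv a Q₁) (fun a => pderiv a Q₂) hT
        (fun a => C (w₀ a)) (fun a => C (w₁ a)) (fun a => C (w₂ a))
    -- (1) `L · K₀ = M₁ K₁ + M₂ K₂`
    have h012 := hcontr v₀ v₁ v₂
    simp only [hDQ1, hDQ2, d0l, d0m1, d0m2, d1l, d1m1, d1m2, d2l, d2m1, d2m2, C_0, C_1, zero_mul, one_mul,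
      add_zero, zero_add, mul_zero] at h012
    have hrel : L * (∑ a : Fin 5, C (v₀ a) * pderiv a K)
        = M₁f * (∑ a : Fin 5, C (v₁ a) * pderiv a K) + M₂f * (∑ a : Fin 5, C (v₂ a) * pderiv a K) := by
      have two0 : (2 : MvPolynomial (Fin 5) ℂ) ≠ 0 := by exact_mod_cast (by norm_num : (2 : ℕ) ≠ 0)
      have h4 : (4 : MvPolynomial (Fin 5) ℂ) * L ≠ 0 := mul_ne_zero (by exact_mod_cast (by norm_num : (4 : ℕ) ≠ 0)) hL0
      apply mul_left_cancel₀ h4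
      linear_combination h012
    -- (2) `D_v K = 0` on the common kernel
    have hker : ∀ v : Fin 5 → ℂ, ∑ a : Fin 5, v a * l a = 0 → ∑ a : Fin 5, v a * m₁ a = 0 → ∑ a : Fin 5, v a * m₂ a = 0 →
        ∑ a : Fin 5, C (v a) * pderiv a K = 0 := by
      intro v hvl hv1 hv2
      have h := hcontr v v₁ v₂
      simp only [hDQ1, hDQ2, hvl, hv1, hv2, d1l, d1m1, d1m2, d2l, d2m1, d2m2, C_0, C_1, zero_mul, one_mul,
        add_zero, zero_add, mul_zero, sub_zero] at h
      have h4 : (2 : MvPolynomial (Fin 5) ℂ) * L * (2 * L) ≠ 0 := by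
        have two0 : (2 : MvPolynomial (Fin 5) ℂ) ≠ 0 := by exact_mod_cast (by norm_num : (2 : ℕ) ≠ 0)
        exact mul_ne_zero (mul_ne_zero two0 hL0) (mul_ne_zero two0 hL0)
      have h' : (∑ a : Fin 5, C (v a) * pderiv a K) * (2 * L * (2 * L)) = 0 := by linear_combination h
      exact (mul_eq_zero.mp h').resolve_right h4
    -- (3) `∂_a K = l_a K₀ + m₁_a K₁ + m₂_a K₂`
    have hpart : ∀ a : Fin 5, pderiv a K = C (l a) * (∑ b : Fin 5, C (v₀ b) * pderiv b K)
        + C (m₁ a) * (∑ b : Fin 5, C (v₁ b) * pderiv b K) + C (m₂ a) * (∑ b : Fin 5, C (v₂ b) * pderiv b K) := by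
      intro a
      set π : Fin 5 → ℂ := fun b => (if b = a then (1 : ℂ) else 0) - l a * v₀ b - m₁ a * v₁ b - m₂ a * v₂ b with hπ
      have hπl : ∑ b : Fin 5, π b * l b = 0 := by
        have e : ∀ b : Fin 5, π b * l b = (if b = a then l b else 0) - l a * (v₀ b * l b) - m₁ a * (v₁ b * l b)
            - m₂ a * (v₂ b * l b) := fun b => by simp only [hπ]; split_ifs <;> ring
        rw [Finset.sum_congr rfl fun b _ => e b, Finset.sum_sub_distrib, Finset.sum_sub_distrib, Finset.sum_sub_distrib,
          Finset.sum_ite_eq', if_pos (Finset.mem_univ _), ← Finset.mul_sum, ← Finset.mul_sum, ← Finset.mul_sum,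
          d0l, d1l, d2l]
        ring
      have hπ1 : ∑ b : Fin 5, π b * m₁ b = 0 := by
        have e : ∀ b : Fin 5, π b * m₁ b = (if b = a then m₁ b else 0) - l a * (v₀ b * m₁ b) - m₁ a * (v₁ b * m₁ b)
            - m₂ a * (v₂ b * m₁ b) := fun b => by simp only [hπ]; split_ifs <;> ring
        rw [Finset.sum_congr rfl fun b _ => e b, Finset.sum_sub_distrib, Finset.sum_sub_distrib, Finset.sum_sub_distrib,
          Finset.sum_ite_eq', if_pos (Finset.mem_univ _), ← Finset.mul_sum, ← Finset.mul_sum, ← Finset.mul_sum,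
          d0m1, d1m1, d2m1]
        ring
      have hπ2 : ∑ b : Fin 5, π b * m₂ b = 0 := by
        have e : ∀ b : Fin 5, π b * m₂ b = (if b = a then m₂ b else 0) - l a * (v₀ b * m₂ b) - m₁ a * (v₁ b * m₂ b)
            - m₂ a * (v₂ b * m₂ b) := fun b => by simp only [hπ]; split_ifs <;> ring
        rw [Finset.sum_congr rfl fun b _ => e b, Finset.sum_sub_distrib, Finset.sum_sub_distrib, Finset.sum_sub_distrib,
          Finset.sum_ite_eq', if_pos (Finset.mem_univ _), ← Finset.mul_sum, ← Finset.mul_sum, ← Finset.mul_sum,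
          d0m2, d1m2, d2m2]
        ring
      have h := hker π hπl hπ1 hπ2
      have e : ∀ b : Fin 5, C (π b) * pderiv b K = C (if b = a then (1 : ℂ) else 0) * pderiv b K
          - C (l a) * (C (v₀ b) * pderiv b K) - C (m₁ a) * (C (v₁ b) * pderiv b K) - C (m₂ a) * (C (v₂ b) * pderiv b K) := by
        intro b
        simp only [hπ, map_sub, map_mul]
        ring
      rw [Finset.sum_congr rfl fun b _ => e b, Finset.sum_sub_distrib, Finset.sum_sub_distrib, Finset.sum_sub_distrib,
        sum_C_ite_mul, C_1, one_mul, ← Finset.mul_sum, ← Finset.mul_sum, ← Finset.mul_sum] at h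
      linear_combination h
    -- (4) Euler: `3K = 2 L K₀`
    have heuler0 := hK3.sum_X_mul_pderiv
    have heuler : ∑ a : Fin 5, (X a : MvPolynomial (Fin 5) ℂ) * (C (l a) * (∑ b : Fin 5, C (v₀ b) * pderiv b K)
        + C (m₁ a) * (∑ b : Fin 5, C (v₁ b) * pderiv b K) + C (m₂ a) * (∑ b : Fin 5, C (v₂ b) * pderiv b K))
        = 3 • K := by
      rw [← heuler0]
      exact Finset.sum_congr rfl fun a _ => by rw [← hpart a]
    have hsum : ∑ a : Fin 5, (X a : MvPolynomial (Fin 5) ℂ) * (C (l a) * (∑ b : Fin 5, C (v₀ b) * pderiv b K)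
        + C (m₁ a) * (∑ b : Fin 5, C (v₁ b) * pderiv b K) + C (m₂ a) * (∑ b : Fin 5, C (v₂ b) * pderiv b K))
        = L * (∑ b : Fin 5, C (v₀ b) * pderiv b K) + M₁f * (∑ b : Fin 5, C (v₁ b) * pderiv b K)
          + M₂f * (∑ b : Fin 5, C (v₂ b) * pderiv b K) := by
      rw [hL, hM₁, hM₂, Finset.sum_mul, Finset.sum_mul, Finset.sum_mul, ← Finset.sum_add_distrib, ← Finset.sum_add_distrib]
      exact Finset.sum_congr rfl fun a _ => by rw [smul_eq_C_mul, smul_eq_C_mul, smul_eq_C_mul]; ring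
    rw [hsum, nsmul_eq_mul, Nat.cast_ofNat] at heuler
    have h3 : C (3 : ℂ) * K = 2 * L * ∑ a : Fin 5, C (v₀ a) * pderiv a K := by
      rw [map_ofNat]
      linear_combination -heuler - hrel
    -- (5) descent
    obtain ⟨G₁, hG₁h, hKG₁, hG₁⟩ := descent_step l v₀ d0l z₀ hl 3 (by norm_num) 2 K hK3 h3
    obtain ⟨G₂, hG₂h, hG₁G₂, hG₂⟩ := descent_step l v₀ d0l z₀ hl (3 - 2) (by norm_num) 1 G₁ hG₁h hG₁
    obtain ⟨G₃, hG₃h, hG₂G₃, hG₃⟩ := descent_step l v₀ d0l z₀ hl (3 - 2 - 2) (by norm_num) 0 G₂ hG₂h hG₂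
    have hG₃0 : G₃ = 0 := descent_base l v₀ (3 - 2 - 2 - 2) (by norm_num) G₃ hG₃h hG₃
    rw [hKG₁, hG₁G₂, hG₂G₃, hG₃0, mul_zero, mul_zero, mul_zero]

end LaplaceFiveStar

end Summit.ValiantsHypothesis.ValiantsHypothesis.Theorems.RigidityForcesSymmetryRankRigidMinimalRepr
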